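import Summits.CriticalPhenomena.SAWScalingLimit.Theses.SAWDevelopingMap
import Summits.CriticalPhenomena.SAWScalingLimit.Theorems.ObservableToSLE.Negative.Identification
import Summits.CriticalPhenomena.SAWScalingLimit.Theorems.SAWDefectDecoherenceObservableToSLERGateDecomposition
import Summits.CriticalPhenomena.SAWScalingLimit.Theorems.SAWDefectDecoherenceObservableToSLERMidTightN
import Summits.CriticalPhenomena.SAWScalingLimit.Theorems.SAWDefectDecoherenceObservableToSLERNestedTransferP
import Summits.CriticalPhenomena.SAWScalingLimit.Theorems.SAWDefectDecoherenceObservableToSLERSeqReductionPM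
import Summits.CriticalPhenomena.SAWScalingLimit.Theorems.SAWDefectDecoherenceObservableToSLERMidModulusN
import Summits.CriticalPhenomena.SAWScalingLimit.Theorems.SAWDevelopingMapObservableToSLETypeLadderCoOrientedReduction
import Summits.CriticalPhenomena.SAWScalingLimit.Theorems.SAWDevelopingMapObservableToSLETypeLadderNestedTransferPR
import HarnessLib

/-!
# Crux `SAWDevelopingMap.ObservableToSLE` (stmt-CriticalPhenomena-10472), line `six-class-type-ladder`
(payload slug `Sketch`): THE LADDER TRANSFER, ASSEMBLED MODULO ITS INPUTS — LOCALITY SCALE BOUNDED (skeleton r3)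

Landing target:
`Summits/CriticalPhenomena/SAWScalingLimit/Theorems/SAWDevelopingMapObservableToSLETypeLadderAssemblyR.lean`
(`--supports stmt-CriticalPhenomena-10472`; continuation lead prover-line-stmt-CriticalPhenomena-10472-c3-0).

Companion of `…TypeLadderAssembly.lean` (p124367), whose abundance hypothesis is the r1/r2 typing
`NestedRenewalP FatAnchoredCoOriented` (`∀ ε > 0, ∀ R > 0, …`) — UNSATISFIABLE (`TypeLadder.stub_not_nestedRenewalP`,
p124536: a good gate carries a `ρ/4`-wide escape to distance `2R` inside the bounded domain), so the two theorems
there are vacuous.  Here the same composition with the locality scale bounded (r3 typing `NestedRenewalPR`: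
`∀ ε > 0, ∃ R₂ > 0, ∀ R ∈ Ioc 0 R₂, …`), through the re-proved transfer `TypeLadder.stub_nestedTransferPR` (p124665):

* `stub_observableToSLE_of_renewalR` (registered sub-goal) — abundance for small locality scales (stub S1 of r3,
  `stub_nestedRenewalFatCoR`, verbatim) → carved convergence under the co-oriented constraint → the crux BY NAME;
* `observableToSLE_of_ladderInputsR` — from the three genuine inputs: (i) abundance (S1 r3), (ii) the uniform
  injectivity modulus (T5), (iii) the class-`(0,0)` carved sequential identification (output of the glue T2),
  plus the crux's own `HexTight`.  `HexObservableLimit` enters the line only through (iii).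
-/

noncomputable section

open scoped BigOperators Topology NNReal ENNReal Classical BoundedContinuousFunction
open Filter Set MeasureTheory Metric
open Literature.Probability.LatticeModels (HexVertex hexGraph hexCenter triZeta Site)
open Literature.Probability.RandomPlanarGeometry
open Literature.Probability.RandomPlanarGeometry.SAW

namespace Summit.CriticalPhenomena.SAWScalingLimit.Theorems.ObservableToSLE.TypeLadder

open Summit.CriticalPhenomena.SAWScalingLimit.Theses.SAWDevelopingMap (HexObservableLimit HexTight ObservableToSLE)
open Summit.CriticalPhenomena.SAWScalingLimit.Theorems.ObservableToSLER.BridgeGate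
open Summit.CriticalPhenomena.SAWScalingLimit.Theorems.ObservableToSLER.NestedGate

/-- **The ladder transfer, assembled, locality scale bounded (registered sub-goal
`stub_observableToSLE_of_renewalR`).**  Nested renewal with fat CO-ORIENTED families for SMALL locality
scales (stub S1 of skeleton r3, `stub_nestedRenewalFatCoR`, verbatim) → uniform convergence of the carved middle
laws to SLE(8/3) of the target under the co-oriented family constraint (`CarvedToSLENP FatAnchoredCoOriented`) →
`ObservableToSLE` BY NAME.  Proof: `TypeLadder.stub_nestedTransferPR` (p124665) with `stub_gateDecomposition`
(p82259), then `Negative.convergesInLawToSLE_of_identification` (p69742) with `HexTight`.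
[cite: DuminilCopinSmirnov2012, Conjecture 1 (arXiv:1007.0575 p. 7), as the conclusion] -/
theorem stub_observableToSLE_of_renewalR :
    (∀ (D : DobrushinDomain) (a b : ℝ → HexVertex), IsEmbEndpointApprox hexGraph hexCenter D a b →
      ∀ ε > (0 : ℝ), ∃ R₂ > (0 : ℝ), ∀ R ∈ Set.Ioc (0 : ℝ) R₂, ∃ ρ > (0 : ℝ), ∃ N : ℕ, ∀ᶠ δ : ℝ in 𝓝[>] 0,
        ∃ S T : ℕ → Set HexVertex,
          TameNestedFamily δ R N (a δ) S ∧ TameNestedFamily δ R N (b δ) T ∧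
          ((∀ n, ExteriorAnchored D.carrier δ (S n) (a δ)) ∧
            (∀ n, ExteriorAnchored D.carrier δ (T n) (b δ)) ∧
            ∃ j : Fin 6,
              ((∀ (n : ℕ) (p q : HexVertex), HasCleanWindow D.carrier δ ρ (S n) p q →
                  rowOf j q = rowOf j p + 1 ∧
                    ∀ x : HexVertex, (δ : ℂ) * hexCenter x ∈ ball ((δ : ℂ) * hexCenter q) ρ →
                      (x ∈ S n ↔ rowOf j x ≤ rowOf j p)) ∧
                (∀ (n : ℕ) (p q : HexVertex), HasCleanWindow D.carrier δ ρ (T n) p q →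
                  rowOf j q = rowOf j p + 1 ∧
                    ∀ x : HexVertex, (δ : ℂ) * hexCenter x ∈ ball ((δ : ℂ) * hexCenter q) ρ →
                      (x ∈ T n ↔ rowOf j x ≤ rowOf j p))) ∧
              (∀ (n : ℕ) (p q : HexVertex), HasCleanWindow D.carrier δ ρ (S n) p q →
                ∃ K : Set ℂ, IsCompact K ∧ IsConnected K ∧
                  (δ : ℂ) * hexCenter q - ((ρ / 2 : ℝ) : ℂ) * Complex.I * triZeta ^ (j : ℕ) ∈ K ∧
                  (δ : ℂ) * hexCenter (a δ) ∈ K ∧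
                  ∀ v : HexVertex, Metric.infDist ((δ : ℂ) * hexCenter v) K ≤ ρ / 4 → v ∈ S n) ∧
              (∀ (n : ℕ) (p q : HexVertex), HasCleanWindow D.carrier δ ρ (T n) p q →
                ∃ K : Set ℂ, IsCompact K ∧ IsConnected K ∧
                  (δ : ℂ) * hexCenter q - ((ρ / 2 : ℝ) : ℂ) * Complex.I * triZeta ^ (j : ℕ) ∈ K ∧
                  (δ : ℂ) * hexCenter (b δ) ∈ K ∧
                  ∀ v : HexVertex, Metric.infDist ((δ : ℂ) * hexCenter v) K ≤ ρ / 4 → v ∈ T n)) ∧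
          hexSAWLaw D.carrier δ (a δ) (b δ)
              {γ | ¬ ∃ (n m : ℕ) (p q : HexVertex) (n' m' : ℕ) (p' q' : HexVertex),
                  IsFirstGoodGateN D.carrier δ ρ R S (a δ) γ.walk.support n m p q ∧
                  IsFirstGoodGateN D.carrier δ ρ R T (b δ) γ.walk.support.reverse n' m' p' q' ∧
                  WideLink D.carrier δ ρ (S n ∪ T n') q q'} ≤
            ENNReal.ofReal ε) →
    (∀ (D : DobrushinDomain) (a b : ℝ → HexVertex), IsEmbEndpointApprox hexGraph hexCenter D a b →
      ∀ (ν : Measure (CurveClass ℂ)), IsSLELaw ((8 : ℝ≥0) / 3) D ν →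
      ∀ (f : CurveClass ℂ →ᵇ ℝ) (ε : ℝ), 0 < ε →
        ∃ R₀ > (0 : ℝ), ∀ R ∈ Set.Ioc (0 : ℝ) R₀, ∀ ρ > (0 : ℝ), ∀ N : ℕ,
          ∀ᶠ δ : ℝ in 𝓝[>] 0, ∀ S T : ℕ → Set HexVertex,
            TameNestedFamily δ R N (a δ) S → TameNestedFamily δ R N (b δ) T →
            ((∀ n, ExteriorAnchored D.carrier δ (S n) (a δ)) ∧
              (∀ n, ExteriorAnchored D.carrier δ (T n) (b δ)) ∧
              ∃ j : Fin 6,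
                ((∀ (n : ℕ) (p q : HexVertex), HasCleanWindow D.carrier δ ρ (S n) p q →
                    rowOf j q = rowOf j p + 1 ∧
                      ∀ x : HexVertex, (δ : ℂ) * hexCenter x ∈ ball ((δ : ℂ) * hexCenter q) ρ →
                        (x ∈ S n ↔ rowOf j x ≤ rowOf j p)) ∧
                  (∀ (n : ℕ) (p q : HexVertex), HasCleanWindow D.carrier δ ρ (T n) p q →
                    rowOf j q = rowOf j p + 1 ∧
                      ∀ x : HexVertex, (δ : ℂ) * hexCenter x ∈ ball ((δ : ℂ) * hexCenter q) ρ →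
                        (x ∈ T n ↔ rowOf j x ≤ rowOf j p))) ∧
                (∀ (n : ℕ) (p q : HexVertex), HasCleanWindow D.carrier δ ρ (S n) p q →
                  ∃ K : Set ℂ, IsCompact K ∧ IsConnected K ∧
                    (δ : ℂ) * hexCenter q - ((ρ / 2 : ℝ) : ℂ) * Complex.I * triZeta ^ (j : ℕ) ∈ K ∧
                    (δ : ℂ) * hexCenter (a δ) ∈ K ∧
                    ∀ v : HexVertex, Metric.infDist ((δ : ℂ) * hexCenter v) K ≤ ρ / 4 → v ∈ S n) ∧
                (∀ (n : ℕ) (p q : HexVertex), HasCleanWindow D.carrier δ ρ (T n) p q →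
                  ∃ K : Set ℂ, IsCompact K ∧ IsConnected K ∧
                    (δ : ℂ) * hexCenter q - ((ρ / 2 : ℝ) : ℂ) * Complex.I * triZeta ^ (j : ℕ) ∈ K ∧
                    (δ : ℂ) * hexCenter (b δ) ∈ K ∧
                    ∀ v : HexVertex, Metric.infDist ((δ : ℂ) * hexCenter v) K ≤ ρ / 4 → v ∈ T n)) →
            hexSAWLaw D.carrier δ (a δ) (b δ)
              {γ | ∃ (n m : ℕ) (p q : HexVertex) (n' m' : ℕ) (p' q' : HexVertex),
                  IsFirstGoodGateN D.carrier δ ρ R S (a δ) γ.walk.support n m p q ∧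
                  IsFirstGoodGateN D.carrier δ ρ R T (b δ) γ.walk.support.reverse n' m' p' q' ∧
                  WideLink D.carrier δ ρ (S n ∪ T n') q q' ∧
                  ε < |(∫ ξ, f ξ.curve ∂(carvedLaw D.carrier δ (S n ∪ T n') q q')) - ∫ x, f x ∂ν|} ≤
              ENNReal.ofReal ε) →
    ObservableToSLE := by
  intro hRen hCarved _hO hT D₀ a₀ b₀ hab
  let P : DobrushinDomain → (ℝ → HexVertex) → (ℝ → HexVertex) → ℝ → ℝ → ℝ → ℕ →
      (ℕ → Set HexVertex) → (ℕ → Set HexVertex) → Prop :=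
    fun D a b δ ρ _R _N S T =>
          ((∀ n, ExteriorAnchored D.carrier δ (S n) (a δ)) ∧
            (∀ n, ExteriorAnchored D.carrier δ (T n) (b δ)) ∧
            ∃ j : Fin 6,
              ((∀ (n : ℕ) (p q : HexVertex), HasCleanWindow D.carrier δ ρ (S n) p q →
                  rowOf j q = rowOf j p + 1 ∧
                    ∀ x : HexVertex, (δ : ℂ) * hexCenter x ∈ ball ((δ : ℂ) * hexCenter q) ρ →
                      (x ∈ S n ↔ rowOf j x ≤ rowOf j p)) ∧
                (∀ (n : ℕ) (p q : HexVertex), HasCleanWindow D.carrier δ ρ (T n) p q →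
                  rowOf j q = rowOf j p + 1 ∧
                    ∀ x : HexVertex, (δ : ℂ) * hexCenter x ∈ ball ((δ : ℂ) * hexCenter q) ρ →
                      (x ∈ T n ↔ rowOf j x ≤ rowOf j p))) ∧
              (∀ (n : ℕ) (p q : HexVertex), HasCleanWindow D.carrier δ ρ (S n) p q →
                ∃ K : Set ℂ, IsCompact K ∧ IsConnected K ∧
                  (δ : ℂ) * hexCenter q - ((ρ / 2 : ℝ) : ℂ) * Complex.I * triZeta ^ (j : ℕ) ∈ K ∧
                  (δ : ℂ) * hexCenter (a δ) ∈ K ∧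
                  ∀ v : HexVertex, Metric.infDist ((δ : ℂ) * hexCenter v) K ≤ ρ / 4 → v ∈ S n) ∧
              (∀ (n : ℕ) (p q : HexVertex), HasCleanWindow D.carrier δ ρ (T n) p q →
                ∃ K : Set ℂ, IsCompact K ∧ IsConnected K ∧
                  (δ : ℂ) * hexCenter q - ((ρ / 2 : ℝ) : ℂ) * Complex.I * triZeta ^ (j : ℕ) ∈ K ∧
                  (δ : ℂ) * hexCenter (b δ) ∈ K ∧
                  ∀ v : HexVertex, Metric.infDist ((δ : ℂ) * hexCenter v) K ≤ ρ / 4 → v ∈ T n))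
  have hfull := stub_nestedTransferPR P stub_gateDecomposition hRen hCarved
  exact Summit.CriticalPhenomena.SAWScalingLimit.Theorems.ObservableToSLE.Negative.convergesInLawToSLE_of_identification
    hab (hT D₀ a₀ b₀ hab) (hfull D₀ a₀ b₀ hab)

/-- **The ladder transfer from its three genuine inputs, locality scale bounded** (`observableToSLE_of_ladderInputsR`,
unregistered corollary): (i) `NestedRenewalPR FatAnchoredCoOriented` (stub S1 r3), (ii) the uniform injectivity
modulus (stub T5), (iii) the class-`(0,0)` carved sequential identification with tightness and modulus given
(output of the glue stub T2), and the crux's own `HexTight`, give `ObservableToSLE` — through the landed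
co-oriented reduction (p123341), sequential reduction (p120538) with averaged tightness (p116996) and modulus
(p120791), and `stub_observableToSLE_of_renewalR`. -/
theorem observableToSLE_of_ladderInputsR :
    (∀ (D : DobrushinDomain) (a b : ℝ → HexVertex), IsEmbEndpointApprox hexGraph hexCenter D a b →
      ∀ ε > (0 : ℝ), ∃ R₂ > (0 : ℝ), ∀ R ∈ Set.Ioc (0 : ℝ) R₂, ∃ ρ > (0 : ℝ), ∃ N : ℕ, ∀ᶠ δ : ℝ in 𝓝[>] 0,
        ∃ S T : ℕ → Set HexVertex,
          TameNestedFamily δ R N (a δ) S ∧ TameNestedFamily δ R N (b δ) T ∧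
          ((∀ n, ExteriorAnchored D.carrier δ (S n) (a δ)) ∧
            (∀ n, ExteriorAnchored D.carrier δ (T n) (b δ)) ∧
            ∃ j : Fin 6,
              ((∀ (n : ℕ) (p q : HexVertex), HasCleanWindow D.carrier δ ρ (S n) p q →
                  rowOf j q = rowOf j p + 1 ∧
                    ∀ x : HexVertex, (δ : ℂ) * hexCenter x ∈ ball ((δ : ℂ) * hexCenter q) ρ →
                      (x ∈ S n ↔ rowOf j x ≤ rowOf j p)) ∧
                (∀ (n : ℕ) (p q : HexVertex), HasCleanWindow D.carrier δ ρ (T n) p q →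
                  rowOf j q = rowOf j p + 1 ∧
                    ∀ x : HexVertex, (δ : ℂ) * hexCenter x ∈ ball ((δ : ℂ) * hexCenter q) ρ →
                      (x ∈ T n ↔ rowOf j x ≤ rowOf j p))) ∧
              (∀ (n : ℕ) (p q : HexVertex), HasCleanWindow D.carrier δ ρ (S n) p q →
                ∃ K : Set ℂ, IsCompact K ∧ IsConnected K ∧
                  (δ : ℂ) * hexCenter q - ((ρ / 2 : ℝ) : ℂ) * Complex.I * triZeta ^ (j : ℕ) ∈ K ∧
                  (δ : ℂ) * hexCenter (a δ) ∈ K ∧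
                  ∀ v : HexVertex, Metric.infDist ((δ : ℂ) * hexCenter v) K ≤ ρ / 4 → v ∈ S n) ∧
              (∀ (n : ℕ) (p q : HexVertex), HasCleanWindow D.carrier δ ρ (T n) p q →
                ∃ K : Set ℂ, IsCompact K ∧ IsConnected K ∧
                  (δ : ℂ) * hexCenter q - ((ρ / 2 : ℝ) : ℂ) * Complex.I * triZeta ^ (j : ℕ) ∈ K ∧
                  (δ : ℂ) * hexCenter (b δ) ∈ K ∧
                  ∀ v : HexVertex, Metric.infDist ((δ : ℂ) * hexCenter v) K ≤ ρ / 4 → v ∈ T n)) ∧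
          hexSAWLaw D.carrier δ (a δ) (b δ)
              {γ | ¬ ∃ (n m : ℕ) (p q : HexVertex) (n' m' : ℕ) (p' q' : HexVertex),
                  IsFirstGoodGateN D.carrier δ ρ R S (a δ) γ.walk.support n m p q ∧
                  IsFirstGoodGateN D.carrier δ ρ R T (b δ) γ.walk.support.reverse n' m' p' q' ∧
                  WideLink D.carrier δ ρ (S n ∪ T n') q q'} ≤
            ENNReal.ofReal ε) →
    (∀ (D : DobrushinDomain) (a b : ℝ → HexVertex), IsEmbEndpointApprox hexGraph hexCenter D a b →
      ∀ ε > (0 : ℝ), ∀ η > (0 : ℝ), ∃ θ > (0 : ℝ), ∀ᶠ δ : ℝ in 𝓝[>] 0,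
        hexSAWLaw D.carrier δ (a δ) (b δ) {γ | γ.curve ∉ CurveClass.modulusClass ε θ} ≤
          ENNReal.ofReal η) →
    (∀ (D : DobrushinDomain) (a b : ℝ → HexVertex), IsEmbEndpointApprox hexGraph hexCenter D a b →
      ∀ (ν : Measure (CurveClass ℂ)), IsSLELaw ((8 : ℝ≥0) / 3) D ν →
      ∀ (f : CurveClass ℂ →ᵇ ℝ) (ε : ℝ), 0 < ε →
        ∃ R₀ > (0 : ℝ), ∀ R ∈ Set.Ioc (0 : ℝ) R₀, ∀ ρ > (0 : ℝ), ∀ N : ℕ,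
          ∀ (δ : ℕ → ℝ) (S T : ℕ → ℕ → Set HexVertex) (n n' : ℕ → ℕ) (q q' : ℕ → HexVertex),
            Tendsto δ atTop (𝓝[>] 0) →
            (∀ k, TameNestedFamily (δ k) R N (a (δ k)) (S k) ∧
              TameNestedFamily (δ k) R N (b (δ k)) (T k) ∧
              (((∀ i, ExteriorAnchored D.carrier (δ k) (S k i) (a (δ k))) ∧
          (∀ i, ExteriorAnchored D.carrier (δ k) (T k i) (b (δ k))) ∧
          (∀ (i : ℕ) (p q : HexVertex), HasCleanWindow D.carrier (δ k) ρ (S k i) p q →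
            rowOf 0 q = rowOf 0 p + 1 ∧
              ∀ x : HexVertex, ((δ k : ℝ) : ℂ) * hexCenter x ∈ ball (((δ k : ℝ) : ℂ) * hexCenter q) ρ →
                (x ∈ S k i ↔ rowOf 0 x ≤ rowOf 0 p)) ∧
          (∀ (i : ℕ) (p q : HexVertex), HasCleanWindow D.carrier (δ k) ρ (T k i) p q →
            rowOf 0 q = rowOf 0 p + 1 ∧
              ∀ x : HexVertex, ((δ k : ℝ) : ℂ) * hexCenter x ∈ ball (((δ k : ℝ) : ℂ) * hexCenter q) ρ →
                (x ∈ T k i ↔ rowOf 0 x ≤ rowOf 0 p))) ∧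
          (∀ (i : ℕ) (p q : HexVertex), HasCleanWindow D.carrier (δ k) ρ (S k i) p q →
            ∃ K : Set ℂ, IsCompact K ∧ IsConnected K ∧
              ((δ k : ℝ) : ℂ) * hexCenter q - ((ρ / 2 : ℝ) : ℂ) * Complex.I ∈ K ∧ ((δ k : ℝ) : ℂ) * hexCenter (a (δ k)) ∈ K ∧
              ∀ v : HexVertex, Metric.infDist (((δ k : ℝ) : ℂ) * hexCenter v) K ≤ ρ / 4 → v ∈ S k i) ∧
          (∀ (i : ℕ) (p q : HexVertex), HasCleanWindow D.carrier (δ k) ρ (T k i) p q →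
            ∃ K : Set ℂ, IsCompact K ∧ IsConnected K ∧
              ((δ k : ℝ) : ℂ) * hexCenter q - ((ρ / 2 : ℝ) : ℂ) * Complex.I ∈ K ∧ ((δ k : ℝ) : ℂ) * hexCenter (b (δ k)) ∈ K ∧
              ∀ v : HexVertex, Metric.infDist (((δ k : ℝ) : ℂ) * hexCenter v) K ≤ ρ / 4 → v ∈ T k i))) →
            (∀ k, ∃ (γ : HexDomainSAW D.carrier (δ k) (a (δ k)) (b (δ k))) (m : ℕ) (p : HexVertex)
                (m' : ℕ) (p' : HexVertex),
              IsFirstGoodGateN D.carrier (δ k) ρ R (S k) (a (δ k)) γ.walk.support (n k) m p (q k) ∧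
              IsFirstGoodGateN D.carrier (δ k) ρ R (T k) (b (δ k)) γ.walk.support.reverse
                (n' k) m' p' (q' k) ∧
              WideLink D.carrier (δ k) ρ (S k (n k) ∪ T k (n' k)) (q k) (q' k)) →
            (∀ k, IsProbabilityMeasure
              (carvedLaw D.carrier (δ k) (S k (n k) ∪ T k (n' k)) (q k) (q' k))) →
            (∀ η > (0 : ℝ), ∃ 𝒦 : Set (CurveClass ℂ), IsCompact 𝒦 ∧ ∀ᶠ k in atTop,
              carvedLaw D.carrier (δ k) (S k (n k) ∪ T k (n' k)) (q k) (q' k)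
                {ξ | ξ.curve ∉ 𝒦} ≤ ENNReal.ofReal η) →
            (∀ ε' > (0 : ℝ), ∀ η > (0 : ℝ), ∃ θ > (0 : ℝ), ∀ᶠ k in atTop,
              carvedLaw D.carrier (δ k) (S k (n k) ∪ T k (n' k)) (q k) (q' k)
                {ξ | ξ.curve ∉ CurveClass.modulusClass ε' θ} ≤ ENNReal.ofReal η) →
            ∀ᶠ k in atTop,
              |(∫ ξ, f ξ.curve ∂(carvedLaw D.carrier (δ k) (S k (n k) ∪ T k (n' k)) (q k) (q' k))) -
                  ∫ x, f x ∂ν| ≤ ε) →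
    ObservableToSLE := by
  intro hRen hMod hCSI hO hT
  let P : DobrushinDomain → (ℝ → HexVertex) → (ℝ → HexVertex) → ℝ → ℝ → ℝ → ℕ →
      (ℕ → Set HexVertex) → (ℕ → Set HexVertex) → Prop :=
    fun D a b δ ρ _R _N S T =>
          ((∀ n, ExteriorAnchored D.carrier δ (S n) (a δ)) ∧
            (∀ n, ExteriorAnchored D.carrier δ (T n) (b δ)) ∧
            ∃ j : Fin 6,
              ((∀ (n : ℕ) (p q : HexVertex), HasCleanWindow D.carrier δ ρ (S n) p q →
                  rowOf j q = rowOf j p + 1 ∧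
                    ∀ x : HexVertex, (δ : ℂ) * hexCenter x ∈ ball ((δ : ℂ) * hexCenter q) ρ →
                      (x ∈ S n ↔ rowOf j x ≤ rowOf j p)) ∧
                (∀ (n : ℕ) (p q : HexVertex), HasCleanWindow D.carrier δ ρ (T n) p q →
                  rowOf j q = rowOf j p + 1 ∧
                    ∀ x : HexVertex, (δ : ℂ) * hexCenter x ∈ ball ((δ : ℂ) * hexCenter q) ρ →
                      (x ∈ T n ↔ rowOf j x ≤ rowOf j p))) ∧
              (∀ (n : ℕ) (p q : HexVertex), HasCleanWindow D.carrier δ ρ (S n) p q →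
                ∃ K : Set ℂ, IsCompact K ∧ IsConnected K ∧
                  (δ : ℂ) * hexCenter q - ((ρ / 2 : ℝ) : ℂ) * Complex.I * triZeta ^ (j : ℕ) ∈ K ∧
                  (δ : ℂ) * hexCenter (a δ) ∈ K ∧
                  ∀ v : HexVertex, Metric.infDist ((δ : ℂ) * hexCenter v) K ≤ ρ / 4 → v ∈ S n) ∧
              (∀ (n : ℕ) (p q : HexVertex), HasCleanWindow D.carrier δ ρ (T n) p q →
                ∃ K : Set ℂ, IsCompact K ∧ IsConnected K ∧
                  (δ : ℂ) * hexCenter q - ((ρ / 2 : ℝ) : ℂ) * Complex.I * triZeta ^ (j : ℕ) ∈ K ∧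
                  (δ : ℂ) * hexCenter (b δ) ∈ K ∧
                  ∀ v : HexVertex, Metric.infDist ((δ : ℂ) * hexCenter v) K ≤ ρ / 4 → v ∈ T n))
  have hCarved := stub_seqReductionPM P (stub_coOrientedReduction hCSI) (stub_midTightN hT)
    (stub_midModulusN hMod)
  exact stub_observableToSLE_of_renewalR hRen hCarved hO hT

end Summit.CriticalPhenomena.SAWScalingLimit.Theorems.ObservableToSLE.TypeLadder

end
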